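import Summits.CriticalPhenomena.CardyFormulaZ2.Theorems.CardyIKTransportIKMixedBoxCrossingTransportStubCylPlane

/-!
# `CardyIKTransport.IKLinearTransport` (stmt-CriticalPhenomena-5076), line `pinned-diagram-exchange`, lead c8 —
# the planar free box law IS the `ν_S`-law of the box observables: `ν_S {boxReadQ ∈ T} = qProb τ T`

Support file (`--supports stmt-CriticalPhenomena-5076`, registered sub-goal `nuMix_boxReadQ_eq_qProb`).  The sister
line's `CylPlane.qProb_TBQ_eq` (`…TransportStubCylPlane`, stmt-5911) identifies the planar free box probability of the
bottom–top crossing with the gauge probability at the origin; THIS FILE frees the event: for EVERY event `T` of the box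
`Q w h` (colours of the `(w+1) × (h+1)` cells at the origin, anti flags of its `w × h` inner faces), the `ν_S`-probability
that the box observables `boxReadQ w h` lie in `T` is `qProb τ T`, `τ` the face-type pattern of `S` on the box columns.
Proof = the template's: the box observables of `obs S ω` are `toQ τ` of the gauge's box data (`boxReadQ_obs`: hon coins
are never read, iso coins are the flags), the gauge's box marginal has atoms `K_g · wt S c` (`BridgeLawStub.gauge_atom`),
and the fibre sum `CylPlane.fiber_sum` regroups `wt` over the fibres of `toQ` into a constant multiple of `qWt`.
-/

noncomputable section

namespace Summit.CriticalPhenomena.CardyFormulaZ2.Theorems.IKLinearTransport.PinnedDiagramExchange.WallDomination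

open scoped BigOperators Classical
open Finset MeasureTheory
open Summit.CriticalPhenomena.CardyFormulaZ2.Theorems.IKLinearTransport.PinnedDiagramExchange.CouplingToLimits
  (measurable_obs isProbabilityMeasure_μIK)
open Summit.CriticalPhenomena.CardyFormulaZ2.Cruxes.IKMixedBoxCrossing.DefectClosureExploration
open CylPlane
open BridgeLawStub (site site_apply_zero wt gauge_atom measurable_gaugeBox measurable_decide)
open BridgeOfLawStub (gaugeBox_fst gaugeBox_snd)

/-- The BOX OBSERVABLES at the origin: the colours of the cells of the box `[0, w] × [0, h]` and the anti flags of its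
inner faces, read from an observable configuration as a planar box configuration `Q w h`. -/
def boxReadQ (w h : ℕ) (x : Obs) : Q w h :=
  (fun p => decide (BridgeLawStub.site p ∈ x.1), fun p => decide (BridgeLawStub.site (p.1.castSucc, p.2.castSucc) ∈ x.2))

namespace BoxReadStub

variable {w h : ℕ}

/-- Under the gauge, the box observables of `obs S ω` are `toQ τ` of the gauge's box data: same colours; on an
isotropic face column the anti flag is the coin, on a honeycomb one it is forced. -/
theorem boxReadQ_obs (S' : Set ℤ) (τ : Fin w → Bool) (hτ : ∀ j : Fin w, τ j = true ↔ ((j : ℕ) : ℤ) ∈ S') (ω : Ω) :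
    boxReadQ w h (obs S' ω) = toQ τ (gaugeBox S' (w + 1) (h + 1) ω) := by
  refine Prod.ext (funext fun p => ?_) (funext fun p => ?_)
  · rw [Bool.eq_iff_iff]
    show decide (site p ∈ blackSet S' ω) = true ↔ (gaugeBox S' (w + 1) (h + 1) ω).1 p = true
    rw [decide_eq_true_eq, gaugeBox_fst]
  · rw [Bool.eq_iff_iff]
    show decide (site (p.1.castSucc, p.2.castSucc) ∈ antiSet S' ω) = true ↔
      (!τ p.1 || (gaugeBox S' (w + 1) (h + 1) ω).2 (p.1.castSucc, p.2.castSucc)) = true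
    rw [decide_eq_true_eq, Bool.or_eq_true, gaugeBox_snd, Bool.not_eq_true', Bool.eq_false_iff, Ne, hτ]
    exact Iff.rfl

/-- The box observables are a measurable function of the observable configuration. -/
theorem measurable_boxReadQ (w h : ℕ) : Measurable (boxReadQ w h) :=
  (measurable_pi_lambda _ fun _ => measurable_decide ((measurable_set_mem _).comp measurable_fst)).prodMk
    (measurable_pi_lambda _ fun _ => measurable_decide ((measurable_set_mem _).comp measurable_snd))

/-- Events of the box observables are measurable. -/
theorem measurableSet_boxReadQ (T : Set (Q w h)) : MeasurableSet {x : Obs | boxReadQ w h x ∈ T} :=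
  measurable_boxReadQ w h (MeasurableSet.of_discrete (s := T))

/-- The `ν_S`-probability of an event of the box observables is a normalised box sum of `wt` (atoms of the gauge's
box marginal, `gauge_atom`) over the `toQ τ`-preimage of the event. -/
theorem nuMix_boxReadQ_eq_boxSum (S' : Set ℤ) (τ : Fin w → Bool)
    (hτ : ∀ j : Fin w, τ j = true ↔ ((j : ℕ) : ℤ) ∈ S') (T : Set (Q w h)) :
    (νmix S').real {x | boxReadQ w h x ∈ T} =
      (∑ d ∈ Finset.univ.filter (fun d => toQ τ d ∈ T), wt S' d.1) / ∑ d : BoxData (w + 1) (h + 1), wt S' d.1 := by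
  haveI := isProbabilityMeasure_μIK
  set ν := μIK.map (gaugeBox S' (w + 1) (h + 1)) with hν
  haveI : IsProbabilityMeasure ν := Measure.isProbabilityMeasure_map (measurable_gaugeBox S' _ _).aemeasurable
  obtain ⟨Kg, hKg⟩ : ∃ Kg : ℝ, ∀ d : BoxData (w + 1) (h + 1), ν.real {d} = Kg * wt S' d.1 :=
    ⟨_, fun d => by obtain ⟨c, κ⟩ := d; exact gauge_atom S' c κ⟩
  have hsum : ∀ F : Finset (BoxData (w + 1) (h + 1)), ν.real ↑F = Kg * ∑ d ∈ F, wt S' d.1 := fun F => by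
    rw [← sum_measureReal_singleton, Finset.mul_sum]
    exact Finset.sum_congr rfl fun d _ => hKg d
  have htot : Kg * ∑ d : BoxData (w + 1) (h + 1), wt S' d.1 = 1 := by
    rw [← hsum Finset.univ, Finset.coe_univ, probReal_univ]
  have hpre : obs S' ⁻¹' {x | boxReadQ w h x ∈ T} =
      gaugeBox S' (w + 1) (h + 1) ⁻¹' ↑(Finset.univ.filter (fun d => toQ τ d ∈ T)) := Set.ext fun ω => by
    rw [Set.mem_preimage, Set.mem_setOf_eq, boxReadQ_obs S' τ hτ, Set.mem_preimage, Finset.mem_coe,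
      Finset.mem_filter]
    exact ⟨fun H => ⟨Finset.mem_univ _, H⟩, fun H => H.2⟩
  unfold νmix
  rw [map_measureReal_apply (measurable_obs S') (measurableSet_boxReadQ T), hpre,
    ← map_measureReal_apply (measurable_gaugeBox S' _ _) MeasurableSet.of_discrete, ← hν, hsum _,
    div_eq_mul_inv, ← eq_inv_of_mul_eq_one_left htot, mul_comm]

end BoxReadStub

open BoxReadStub in
/-- **The planar free box law IS the `ν_S`-law of the box observables** (registered sub-goal
`nuMix_boxReadQ_eq_qProb`): for every column pattern `S'`, its face types `τ` on the box columns and every event `T`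
of the box, `ν_{S'} {x | boxReadQ w h x ∈ T} = qProb τ T`. -/
theorem nuMix_boxReadQ_eq_qProb : ∀ {w h : ℕ} (S' : Set ℤ) (τ : Fin w → Bool),
    (∀ j : Fin w, τ j = true ↔ ((j : ℕ) : ℤ) ∈ S') → ∀ T : Set (Q w h),
    (νmix S').real {x | boxReadQ w h x ∈ T} = qProb τ T := by
  intro w h S' τ hτ T
  obtain ⟨C, hC, hfib⟩ := fiber_sum (h := h) S' τ hτ
  rw [nuMix_boxReadQ_eq_boxSum S' τ hτ T]
  have regroup : ∀ F : Q w h → ℝ,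
      ∑ d : BoxData (w + 1) (h + 1), F (toQ τ d) * wt S' d.1 = ∑ q, F q * (C * qWt τ q) := fun F => by
    simp_rw [← hfib, Finset.mul_sum]
    rw [Finset.sum_comm]
    refine Finset.sum_congr rfl fun d _ => ?_
    rw [Finset.sum_eq_single_of_mem (toQ τ d) (Finset.mem_univ _)]
    · rw [if_pos rfl]
    · intro q _ hq; rw [if_neg (Ne.symm hq), mul_zero]
  set F : Q w h → ℝ := fun q => if q ∈ T then 1 else 0 with hF
  have e1 : ∑ d ∈ Finset.univ.filter (fun d => toQ τ d ∈ T), wt S' d.1 =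
      ∑ d : BoxData (w + 1) (h + 1), F (toQ τ d) * wt S' d.1 := by
    rw [Finset.sum_filter]
    refine Finset.sum_congr rfl fun d _ => ?_
    simp only [hF]
    split_ifs <;> simp
  have e2 : ∑ d : BoxData (w + 1) (h + 1), wt S' d.1 =
      ∑ d : BoxData (w + 1) (h + 1), (fun _ => (1 : ℝ)) (toQ τ d) * wt S' d.1 := by simp
  have e3 : ∑ q : Q w h, F q * (C * qWt τ q) = C * ∑ q, (if q ∈ T then qWt τ q else 0) := by
    rw [Finset.mul_sum]
    exact Finset.sum_congr rfl fun q _ => by simp only [hF]; split_ifs <;> ring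
  have e4 : ∑ q : Q w h, (fun _ => (1 : ℝ)) q * (C * qWt τ q) = C * ∑ q : Q w h, qWt τ q := by
    rw [Finset.mul_sum]; exact Finset.sum_congr rfl fun q _ => by ring
  rw [e1, e2, regroup F, regroup (fun _ => 1), e3, e4, mul_div_mul_left _ _ hC.ne']
  rfl

end Summit.CriticalPhenomena.CardyFormulaZ2.Theorems.IKLinearTransport.PinnedDiagramExchange.WallDomination

end
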